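import Literature.NumberTheory.ModularForms.BinaryQuadGaussSumAllModuli
import HarnessLib

/-!
# Gauss sums of binary quadratic forms, VIII: the PHASE at a general modulus —
# `G(a, c; f, 0) = ((a·A)/s) · E(c)` with `E(c)` independent of the form, `|E(c)| = c√s`

Topic `NumberTheory/ModularForms` (namespace `Literature.NumberTheory.ModularForms`), assembling
files III (odd moduli), V (Chinese remainder theorem) and VI (`2^k`). Everything here is PROVED
(theorems only; no definition, no named fact).

Setting: an integral form `f = (A, B, C)` with ODD discriminant `D`, a modulus
`c = 2^k·s·c₁` with `s, c₁` odd, a factorisation `D = s·D₁` with `(D₁, c₁) = 1` (for the forms of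
discriminant `−q`, `q` squarefree, and ANY `c ≥ 1` this holds with `s = (c, q)`, `r = q/s = −D₁`,
`2^k c₁ = c/s`), a numerator `a` prime to `c`, and leading coefficient `A` prime to `c` (for a
PRIMITIVE `f` one passes to a properly equivalent form with this property, Cox Lemma 2.25, which
changes neither the untwisted sum nor `D`):

* `binQuadGaussSum_zero_zero_eq_phase_odd` — odd `c = s·c₁`:
  `G(a, c; f, 0) = ((aA)/s) · (−D₁/c₁) · G(1; c) · s · G(1; c₁)`.
* `binQuadGaussSum_zero_zero_eq_phase` — general `c = 2^k·s·c₁`: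
  **`G(a, c; f, 0) = ((aA)/s) · E`, `E = χ₈(D)^k 2^k (2^k/s) · (−D₁/c₁) G(1; sc₁) s G(1; c₁)`**,
  where `E` depends only on `c, k, s, c₁, D, D₁` — NOT on the form or on `a` beyond `(aA/s)`:
  the numerator enters through `χ_s(a) = (a/s)` and the form only through `χ_s(A) = (A/s)`, the
  value of the genus character of `s` on the class of `f` (`A = f(1,0)` is represented by `f` and
  prime to `s`). For the class-group theta series this is the factorisation
  `η = χ_s(a)·η₀(c)·ψ_s([f])` of the pseudo-eigenvalue at the cusp `a/c`, `(c, q) = s`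
  (Conrey–Iwaniec (3.15), (3.17)–(3.18)); `…_of_properEquiv` is the same with `A` the leading
  coefficient of any properly equivalent form prime to `c`.
* `norm_phaseFactor` — **`|E| = c·√s`** (so `|G(a, c; f, 0)| = c√s`; the modulus itself is
  also the tree's `BinaryQuadGaussSumNorm.norm_binQuadGaussSum_zero_zero_eq`, by Parseval).
* `jacobiSym_a_eq_of_properEquiv` — `(g.a/s)` for `g ~ f` with `(g.a, s) = 1` is a class invariant
  (the genus character of `s` on the class, in form language).

## References

* A. N. Andrianov, V. G. Zhuravlev, *Modular Forms and Hecke Operators*, Transl. Math. Monogr.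
  145, AMS (1995/2015), Ch. 1 §4.4 Proposition 4.9, Theorem 4.10; §4.5 Lemmas 4.13–4.14, (4.49)
  [AndrianovZhuravlev2015].
* B. Conrey, H. Iwaniec, Acta Arith. 103 (2002) 259–312, §3 (3.15), (3.17)–(3.18) [ConreyIwaniec2002].
* D. A. Cox, *Primes of the form x² + ny²*, 2nd ed. (2013), §2.C Lemma 2.25, §3.B (genus
  characters by represented values) [Cox2013].
-/

noncomputable section

open Complex Finset

namespace Literature.NumberTheory.ModularForms

open Literature.NumberTheory.EllipticCurves.ModularForms
open Literature.NumberTheory.QuadraticFields.Quadratic (BinQF)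
open Literature.NumberTheory.LFunctions (norm_stdAddChar)

open scoped NumberTheorySymbols

/-- `(x/n) = ±1` as a complex number when `(x, n) = 1` (plumbing). [folklore] -/
private theorem jacobiSym_sq_cast {x : ℤ} {n : ℕ} (h : x.gcd n = 1) :
    ((jacobiSym x n : ℤ) : ℂ) ^ 2 = 1 := by
  exact_mod_cast jacobiSym.sq_one h

/-- `|(x/n)| = 1` as a complex number when `(x, n) = 1` (plumbing). [folklore] -/
private theorem norm_jacobiSym_cast {x : ℤ} {n : ℕ} (h : x.gcd n = 1) :
    ‖((jacobiSym x n : ℤ) : ℂ)‖ = 1 := by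
  rcases jacobiSym.eq_one_or_neg_one h with h' | h' <;> rw [h'] <;> simp

/-! ### Odd modulus -/

/-- **The phase at an odd modulus.** For odd `c = s·c₁`, `D = s·D₁` with `(D₁, c₁) = 1`, and
`(aA, c) = 1`: `G(a, c; f, 0) = ((aA)/s) · ((−D₁/c₁) · G(1; c) · s · G(1; c₁))` — the closed form
of file III (`…_eq_of_factorisation`) with `(a/c)(a/c₁) = (a/s)`, `(A/c)(−AD₁/c₁) = (A/s)(−D₁/c₁)`.
[cite: AndrianovZhuravlev2015, Ch. 1 §4.4–4.5, Proposition 4.9 and Lemma 4.13] -/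
theorem binQuadGaussSum_zero_zero_eq_phase_odd {c : ℕ} [NeZero c] (hc : Odd c) (f : BinQF)
    (hA : f.a.gcd c = 1) {s c₁ : ℕ} [NeZero s] [NeZero c₁] (hcs : c = s * c₁) {D₁ : ℤ}
    (hD : f.disc = s * D₁) (hD₁ : D₁.gcd c₁ = 1) {a : ℤ} (ha : a.gcd c = 1) :
    binQuadGaussSum c f a 0 0 =
      jacobiSym (a * f.a) s *
        ((jacobiSym (-D₁) c₁ : ℂ) * quadGaussSum c 1 0 * s * quadGaussSum c₁ 1 0) := by
  have cop := fun {x : ℤ} {n : ℕ} (h : x.gcd n = 1) ↦ Int.isCoprime_iff_gcd_eq_one.mpr h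
  have dvd₁ : (c₁ : ℤ) ∣ (c : ℤ) := ⟨s, by rw [hcs]; push_cast; ring⟩
  have ha₁ : a.gcd c₁ = 1 := Int.isCoprime_iff_gcd_eq_one.mp ((cop ha).of_isCoprime_of_dvd_right dvd₁)
  have hA₁ : f.a.gcd c₁ = 1 :=
    Int.isCoprime_iff_gcd_eq_one.mp ((cop hA).of_isCoprime_of_dvd_right dvd₁)
  have hsplit_a : jacobiSym a c = jacobiSym a s * jacobiSym a c₁ := by
    rw [hcs]; exact jacobiSym.mul_right' a (NeZero.ne s) (NeZero.ne c₁)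
  have hsplit_A : jacobiSym f.a c = jacobiSym f.a s * jacobiSym f.a c₁ := by
    rw [hcs]; exact jacobiSym.mul_right' f.a (NeZero.ne s) (NeZero.ne c₁)
  rw [binQuadGaussSum_zero_zero_eq_of_factorisation hc f hA hcs hD hD₁ ha, hsplit_a, hsplit_A,
    show -(f.a * D₁) = f.a * (-D₁) by ring, jacobiSym.mul_left f.a (-D₁) c₁,
    jacobiSym.mul_left a f.a s]
  have h1 := jacobiSym_sq_cast ha₁
  have h2 := jacobiSym_sq_cast hA₁
  push_cast
  linear_combination ((jacobiSym a s : ℂ) * (jacobiSym f.a s : ℂ) * (jacobiSym f.a c₁ : ℂ) ^ 2 *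
      ((jacobiSym (-D₁) c₁ : ℂ) * quadGaussSum c 1 0 * s * quadGaussSum c₁ 1 0)) * h1 +
    ((jacobiSym a s : ℂ) * (jacobiSym f.a s : ℂ) *
      ((jacobiSym (-D₁) c₁ : ℂ) * quadGaussSum c 1 0 * s * quadGaussSum c₁ 1 0)) * h2

/-! ### General modulus `c = 2^k·s·c₁` -/

/-- An odd discriminant forces an odd middle coefficient (plumbing). [folklore] -/
private theorem odd_b_of_odd_disc {f : BinQF} (h : Odd f.disc) : Odd f.b := by
  have : f.b * f.b = f.disc + 2 * (2 * f.a * f.c) := by rw [BinQF.disc]; ring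
  have hbb : Odd (f.b * f.b) := by rw [this]; exact h.add_even (even_two_mul _)
  exact (Int.odd_mul.mp hbb).1

/-- **The phase at a general modulus.** Let `D` be odd, `c = 2^k·(s·c₁)` with `s, c₁` odd,
`D = s·D₁` with `(D₁, c₁) = 1`, and `(aA, c) = 1`. Then
`G(a, c; f, 0) = ((aA)/s) · E` with
`E = χ₈(D)^k·2^k·(2^k/s)·((−D₁/c₁)·G(1; sc₁)·s·G(1; c₁))` — independent of the form beyond
`(A/s)` and of `a` beyond `(a/s)`: `G = G(c'a, 2^k)·G(2^k a, c')` (file V, `c' = sc₁`),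
`G(·, 2^k) = χ₈(D)^k 2^k` (file VI), and the odd phase at `c'` with numerator `2^k a`.
[cite: AndrianovZhuravlev2015, Ch. 1 §4.4–4.5, Proposition 4.9, Theorem 4.10 and Lemma 4.13 (4.49)] -/
theorem binQuadGaussSum_zero_zero_eq_phase (f : BinQF) (hDodd : Odd f.disc) {k s c₁ : ℕ}
    [NeZero s] [NeZero c₁] (hs : Odd s) (hc₁ : Odd c₁) {c : ℕ} [NeZero c]
    (hc : c = 2 ^ k * (s * c₁)) {D₁ : ℤ}
    (hD : f.disc = s * D₁) (hD₁ : D₁.gcd c₁ = 1) (hA : f.a.gcd c = 1) {a : ℤ} (ha : a.gcd c = 1) :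
    binQuadGaussSum c f a 0 0 =
      jacobiSym (a * f.a) s *
        (((ZMod.χ₈ f.disc : ℤ) : ℂ) ^ k * 2 ^ k * jacobiSym (2 ^ k) s *
          ((jacobiSym (-D₁) c₁ : ℂ) * quadGaussSum (s * c₁) 1 0 * s * quadGaussSum c₁ 1 0)) := by
  subst hc
  haveI : NeZero (2 ^ k) := ⟨pow_ne_zero k two_ne_zero⟩
  haveI : NeZero (s * c₁) := ⟨mul_ne_zero (NeZero.ne s) (NeZero.ne c₁)⟩
  have hb : Odd f.b := odd_b_of_odd_disc hDodd
  have hc'odd : Odd (s * c₁) := hs.mul hc₁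
  have hcop : Nat.Coprime (2 ^ k) (s * c₁) := (Nat.coprime_two_left.mpr hc'odd).pow_left k
  have cop := fun {x : ℤ} {n : ℕ} (h : x.gcd n = 1) ↦ Int.isCoprime_iff_gcd_eq_one.mpr h
  have dvd₂ : ((s * c₁ : ℕ) : ℤ) ∣ ((2 ^ k * (s * c₁) : ℕ) : ℤ) := ⟨2 ^ k, by push_cast; ring⟩
  have h2c : IsCoprime ((2 ^ k : ℕ) : ℤ) ((s * c₁ : ℕ) : ℤ) := Nat.isCoprime_iff_coprime.mpr hcop
  have ha' : (((2 ^ k : ℕ) : ℤ) * a).gcd (s * c₁ : ℕ) = 1 :=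
    Int.isCoprime_iff_gcd_eq_one.mp (h2c.mul_left ((cop ha).of_isCoprime_of_dvd_right dvd₂))
  have hA' : f.a.gcd (s * c₁ : ℕ) = 1 :=
    Int.isCoprime_iff_gcd_eq_one.mp ((cop hA).of_isCoprime_of_dvd_right dvd₂)
  have hsa : (((2 ^ k : ℕ) : ℤ) * a).gcd s = 1 :=
    Int.isCoprime_iff_gcd_eq_one.mp ((cop ha').of_isCoprime_of_dvd_right ⟨c₁, by push_cast; ring⟩)
  -- split by the Chinese remainder theorem
  rw [show (0 : ZMod (2 ^ k * (s * c₁))) = ((0 : ℤ) : ZMod (2 ^ k * (s * c₁))) from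
      Int.cast_zero.symm, binQuadGaussSum_mul_of_coprime hcop f a 0 0]
  simp only [Int.cast_zero]
  rw [binQuadGaussSum_zero_zero_eq_phase_odd hc'odd f hA' rfl hD hD₁ ha',
    jacobiSym.mul_left (((2 ^ k : ℕ) : ℤ) * a) f.a s, jacobiSym.mul_left ((2 ^ k : ℕ) : ℤ) a s,
    jacobiSym.mul_left a f.a s]
  -- the `2`-part
  rcases Nat.eq_zero_or_pos k with rfl | hk
  · rw [binQuadGaussSum_eq_one_of_modulus_eq_one (pow_zero 2)]
    push_cast
    simp only [pow_zero, jacobiSym.one_left]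
    push_cast
    ring
  · have haodd : Odd (((s * c₁ : ℕ) : ℤ) * a) := by
      refine ((Int.odd_coe_nat _).mpr hc'odd).mul ?_
      rw [← Int.not_even_iff_odd, even_iff_two_dvd]
      intro h2a
      have h2c : (2 : ℤ) ∣ ((2 ^ k * (s * c₁) : ℕ) : ℤ) :=
        ⟨2 ^ (k - 1) * (s * c₁), by
          rw [show k = (k - 1) + 1 from (Nat.sub_add_cancel hk).symm]; push_cast; ring⟩
      have := Int.dvd_gcd h2a h2c
      rw [ha] at this
      norm_num at this
    rw [binQuadGaussSum_two_pow_eq f hb haodd k]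
    push_cast
    ring

/-- **The phase for a PRIMITIVE form**, read on any properly equivalent form `g` whose leading
coefficient is prime to `c` (such `g` exist, `BinQF.exists_properEquiv_isCoprime_a`; the value
`(g.a/s)` is then independent of the choice — it is the genus character of `s` on the class):
`G(a, c; f, 0) = ((a·g.a)/s) · E`. [cite: AndrianovZhuravlev2015, Ch. 1 §4.4–4.5, Proposition 4.9, Theorem 4.10 and Lemma 4.13 (4.49)] -/
theorem binQuadGaussSum_zero_zero_eq_phase_of_properEquiv {f g : BinQF} (hfg : f.ProperEquiv g)
    (hDodd : Odd f.disc) {k s c₁ : ℕ} [NeZero s] [NeZero c₁] (hs : Odd s) (hc₁ : Odd c₁)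
    {c : ℕ} [NeZero c]
    (hc : c = 2 ^ k * (s * c₁)) {D₁ : ℤ} (hD : f.disc = s * D₁) (hD₁ : D₁.gcd c₁ = 1)
    (hgA : g.a.gcd c = 1) {a : ℤ} (ha : a.gcd c = 1) :
    binQuadGaussSum c f a 0 0 =
      jacobiSym (a * g.a) s *
        (((ZMod.χ₈ f.disc : ℤ) : ℂ) ^ k * 2 ^ k * jacobiSym (2 ^ k) s *
          ((jacobiSym (-D₁) c₁ : ℂ) * quadGaussSum (s * c₁) 1 0 * s * quadGaussSum c₁ 1 0)) := by
  obtain ⟨p, q, r, t, hdet, rfl⟩ := hfg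
  have hdisc : (f.act p q r t).disc = f.disc := by rw [BinQF.disc_act, hdet, one_pow, one_mul]
  rw [← binQuadGaussSum_zero_zero_eq_of_properEquiv ⟨p, q, r, t, hdet, rfl⟩, ← hdisc]
  exact binQuadGaussSum_zero_zero_eq_phase (f.act p q r t) (hdisc ▸ hDodd) hs hc₁ hc
    (hdisc ▸ hD) hD₁ hgA ha

/-- **`|E| = c·√s`** for the form-independent factor `E` of `binQuadGaussSum_zero_zero_eq_phase`
(`c = 2^k·(s·c₁)`; `|E| = 2^k·√(sc₁)·s·√c₁`). This is the normalisation `|η| = 1` of the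
pseudo-eigenvalue `η = −i·G(a,c;f,0)/(c√s)` of the binary theta series at the cusp `a/c`.
[cite: AndrianovZhuravlev2015, Ch. 1 §4.5 Lemmas 4.13–4.14] -/
theorem norm_phaseFactor {D D₁ : ℤ} (hDodd : Odd D) (k : ℕ) {s c₁ : ℕ} [NeZero s] [NeZero c₁]
    (hs : Odd s) (hc₁ : Odd c₁) (hD₁ : D₁.gcd c₁ = 1) :
    ‖((ZMod.χ₈ D : ℤ) : ℂ) ^ k * 2 ^ k * jacobiSym (2 ^ k) s *
        ((jacobiSym (-D₁) c₁ : ℂ) * quadGaussSum (s * c₁) 1 0 * s * quadGaussSum c₁ 1 0)‖ =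
      ((2 ^ k * (s * c₁) : ℕ) : ℝ) * Real.sqrt s := by
  haveI : NeZero (s * c₁) := ⟨mul_ne_zero (NeZero.ne s) (NeZero.ne c₁)⟩
  have cop := fun {x : ℤ} {n : ℕ} (h : x.gcd n = 1) ↦ Int.isCoprime_iff_gcd_eq_one.mpr h
  have h2s : ((2 : ℤ) ^ k).gcd s = 1 := by
    have : IsCoprime (2 : ℤ) s := by
      rw [Int.isCoprime_iff_gcd_eq_one]; exact_mod_cast Nat.coprime_two_left.mpr hs
    exact Int.isCoprime_iff_gcd_eq_one.mp (this.pow_left)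
  have hD₁' : (-D₁).gcd c₁ = 1 := Int.isCoprime_iff_gcd_eq_one.mp (cop hD₁).neg_left
  have hχ : ‖((ZMod.χ₈ D : ℤ) : ℂ)‖ = 1 := by
    rw [ZMod.χ₈_int_eq_if_mod_eight]
    have : D % 2 = 1 := Int.odd_iff.mp hDodd
    rw [if_neg (by omega)]
    split_ifs <;> norm_num
  simp only [norm_mul, norm_pow, norm_jacobiSym_cast hD₁', hχ, norm_quadGaussSum_one (hs.mul hc₁),
    norm_quadGaussSum_one hc₁, Complex.norm_natCast, Complex.norm_ofNat, one_pow, one_mul]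
  rw [show ((jacobiSym (2 ^ k) s : ℤ) : ℂ) = ((jacobiSym ((2 : ℤ) ^ k) s : ℤ) : ℂ) by norm_cast,
    norm_jacobiSym_cast h2s, mul_one,
    show Real.sqrt ((s * c₁ : ℕ) : ℝ) = Real.sqrt s * Real.sqrt c₁ by
      rw [Nat.cast_mul, Real.sqrt_mul (Nat.cast_nonneg _)]]
  have hr := Real.mul_self_sqrt (Nat.cast_nonneg c₁ : (0 : ℝ) ≤ c₁)
  push_cast
  linear_combination (2 ^ k * Real.sqrt s * s) * hr

/-! ### Consequence: the genus character of `s` is well defined on proper equivalence classes -/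

/-- **The Jacobi symbol `(A/s)` of a leading coefficient prime to `s` is an invariant of the
proper equivalence class** (odd `s ∣ D`, `D` odd): if `g ~ f ~ g'` have leading coefficients
prime to `s`, then `(g.a/s) = (g'.a/s)` — read off from the phase at the modulus `c = s`
(`G(1, s; g, 0) = (g.a/s)·E = G(1, s; g', 0) = (g'.a/s)·E`, `|E| = s√s ≠ 0`). This is the form
side of "the genus character `χ_s` is well defined on classes" (Cox §3.B), here as a corollary
of the Gauss-sum evaluation. [cite: Cox2013, §3.B Lemma 3.17 with Theorem 3.15] -/
theorem jacobiSym_a_eq_of_properEquiv {f g g' : BinQF} (hDodd : Odd f.disc)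
    (hfg : f.ProperEquiv g) (hfg' : f.ProperEquiv g') {s : ℕ} [NeZero s] (hs : Odd s)
    (hsD : (s : ℤ) ∣ f.disc) (hg : g.a.gcd s = 1) (hg' : g'.a.gcd s = 1) :
    jacobiSym g.a s = jacobiSym g'.a s := by
  obtain ⟨D₁, hD⟩ := hsD
  have hc : s = 2 ^ 0 * (s * 1) := by simp
  have h1s : (1 : ℤ).gcd s = 1 := by simp
  have hD₁ : D₁.gcd 1 = 1 := by simp
  have e1 := binQuadGaussSum_zero_zero_eq_phase_of_properEquiv hfg hDodd hs odd_one hc hD hD₁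
    (by simpa using hg) h1s
  have e2 := binQuadGaussSum_zero_zero_eq_phase_of_properEquiv hfg' hDodd hs odd_one hc hD hD₁
    (by simpa using hg') h1s
  rw [one_mul] at e1 e2
  -- the common factor `E` is nonzero
  have hE : ((ZMod.χ₈ f.disc : ℤ) : ℂ) ^ 0 * 2 ^ 0 * (jacobiSym (2 ^ 0) s : ℂ) *
      ((jacobiSym (-D₁) 1 : ℂ) * quadGaussSum (s * 1) 1 0 * s * quadGaussSum 1 1 0) ≠ 0 := by
    have hG : quadGaussSum (s * 1) 1 0 ≠ 0 := by
      intro h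
      have := norm_quadGaussSum_one (c := s * 1) (by simpa using hs)
      rw [h, norm_zero] at this
      exact (Real.sqrt_ne_zero'.mpr (by exact_mod_cast Nat.pos_of_ne_zero (NeZero.ne (s * 1))))
        this.symm
    have h1 : quadGaussSum 1 1 0 = 1 := quadGaussSum_eq_one_of_eq_one rfl 1 0
    simp only [pow_zero, jacobiSym.one_left, jacobiSym.one_right, Int.cast_one, one_mul, h1,
      mul_one]
    exact mul_ne_zero hG (Nat.cast_ne_zero.mpr (NeZero.ne s))
  have := e1.symm.trans e2
  have hJ := mul_right_cancel₀ hE this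
  exact_mod_cast hJ

end Literature.NumberTheory.ModularForms

end
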